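import Summits.BirchSwinnertonDyer.Rank1Residual.Additive.RamifiedOrdinaryLineExponent
import Summits.BirchSwinnertonDyer.Rank1Residual.Additive.RamifiedOrdinaryLineMatchingModelFree
import HarnessLib

/-!
# LINE MATCHING on the (G-ord) rows of EVERY semistability defect — Gord × Gord and Gord × (M) links,
# `p ≥ 5`, off the swap locus `(p − 1) ∣ lcm(e₁, e₂)` — by cc-typer-2's model-free matching fed
# with the inertia exponents of T-ROL-EXP
# (cell `b2b-bsdres`, team n1011, seat p07 (gen 7); row T-ROL-EXP FILE C; the `hlines` binder of
# p12's model-free Greenberg–Vatsal count `GreenbergVatsalTransferCountModelFree`)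

HONEST FRAMING (cell `b2b-bsdres`, run/shared/lean/b2b/bsd-rank1-residual/, verbatim in every
file): the goal of the cell is to DELETE the COMBINATION-SHAPED residual classes of the
Birch–Swinnerton-Dyer formula for ALL analytic-rank `≤ 1` elliptic curves over `ℚ` — "full BSD
formula for every rank `≤ 1` curve in class `C`" assembled STRICTLY from published theorems — so
that the rank-`≤ 1` remainder becomes exactly the CONSTRUCTION-SHAPED classes, which are TYPED
(missing-input `Prop`s), NOT attempted. This is not "finishing BSD". Team n1011 (N10/N11 on the
(G-ord) rows of defect `e ∈ {2,3,4,6}` and the (M) rows): research route; labels and marks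
UNCHANGED; nothing booked. TOOL theorems only: NO definition, NO named fact. §2 is CONDITIONAL on the
tree's EXISTING named facts A40/A41 (`hT40`, `hT41`) exactly as the consumed (M) line file; §1 is
unconditional.

## What and why

Greenberg–Vatsal's transfer along a congruence `E₁[p] ≅ E₂[p]` needs the congruence to RESPECT the
ramified ordinary lines ("the same `p`-stabilisation", EPW pp. 2–3; GV p. 26). The tree proved this
automatically on defect-2 links through twist models (p07 `RamifiedOrdinaryLineMatching[Mixed]`,
p12 `GreenbergVatsalTransferMatching`); on links with a member of defect `e ∈ {3,4,6}` no twist model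
exists. cc-typer-2's S3 (`IsRamifiedOrdinaryLine.exists_lines_matching_of_not_dvd_lcm`, p288081)
proves matching MODEL-FREE from explicit inertia exponents `n₁, n₂` with `(p−1) ∤ lcm(n₁, n₂)`; row
T-ROL-EXP supplies the exponents: `e = semistabilityIndex` on (G-ord) rows (FILE B
`exists_isRamifiedOrdinaryLine_and_pow_semistabilityIndex_of_typeGOrd`,
`IsRamifiedOrdinaryLine.pow_semistabilityIndex_smul_sub_mem`), `2` on (M) rows (FILE B0
`PotMult.exists_isRamifiedOrdinaryLine_and_sq`). This file composes them:

* §1 Gord × Gord: **`exists_lines_matching_of_typeGOrd_typeGOrd_of_not_dvd_lcm`** (`p ≥ 5`, both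
  members (G)-ordinary additive of ANY defects `e₁, e₂`, side condition
  `¬ (p − 1) ∣ lcm(e₁, e₂)`) in the `∃ L₁ L₂, … ∧ ∀ e equivariant, …` shape of p12's `hlines`, and the
  `∀`-lines form `inclusion_mem_iff_of_typeGOrd_typeGOrd_of_not_dvd_lcm` (any given lines);
* §2 Gord × (M) and (M) × Gord (mod A40/A41): `…_of_typeGOrd_potMult_…`, `…_of_potMult_typeGOrd_…`
  with `lcm(e₁, 2)`;
* §3 the `∀ v ∋ p` packaging `forall_exists_lines_matching_…` = p12's `hlines` VERBATIM.

HONEST LIMIT (cc-typer-2 S3 SCOPE, skeleton §5): sufficient, not necessary — ON the swap locus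
`(p−1) ∣ lcm(e₁,e₂)` ((5;4,·), (7;6,·), (7;3,2), (13;{3,4}), (13;{4,6})) nothing is claimed; the
equal-parity links there DO match but certifying it needs the exact quotient character (located gap
`κ_{p^{1/e}}|_{I_v} = ω^{(p−1)/e}`). Defect-2 × defect-2 links keep their twist-model theorems (every
odd `p`, `p = 3` included).

References: R. Greenberg, V. Vatsal, Invent. Math. 142 (2000) §2 p. 26, Remark (2.9)
[GreenbergVatsal2000]; M. Emerton, R. Pollack, T. Weston, Invent. Math. 163 (2006) pp. 2–3, §3.1
[EmertonPollackWeston2006]; J.-P. Serre, J. Tate, Ann. of Math. 88 (1968) §2 [SerreTate1968];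
cells/n1011/skel/T-ROL-EXP.md (67779f27699eb635); HOME/INBOX.md 2026-08-21T15:59Z (p12, `hlines`
shape), 16:14Z (cc-typer-2 S3).
-/

set_option autoImplicit false

noncomputable section

open scoped Classical NumberField

open NumberField IsDedekindDomain Field WeierstrassCurve
  Literature.NumberTheory.GaloisRepresentations
  Literature.NumberTheory.EllipticCurves
  Literature.NumberTheory.EllipticCurves.Rank1Residual
  Literature.NumberTheory.EllipticCurves.GreenbergSelmer
  Literature.NumberTheory.EllipticCurves.EmertonPollackWeston2006
  IsDedekindDomain.HeightOneSpectrum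
open WeierstrassCurve (geomTorsion geomPrimaryTorsion geomTorsion_le_geomPrimaryTorsion)

namespace Summit.BirchSwinnertonDyer.Rank1Residual.Additive

namespace GordHigherLineMatching

/-! ### §1 Gord × Gord links of any defects -/

section GordGord

variable {W₁ W₂ : WeierstrassCurve ℚ} [W₁.IsElliptic] [W₁.IsGloballyMinimal] [W₂.IsElliptic]
  [W₂.IsGloballyMinimal] {p : ℕ} [hp : Fact p.Prime] {v : HeightOneSpectrum (𝓞 ℚ)}

/-- **MATCHING OF ANY GIVEN LINES on a Gord × Gord link off the swap locus.** `p ≥ 5`, `E₁`, `E₂`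
globally minimal, additive at `p` of type (G)-ordinary with defects `e₁ = semistabilityIndex W₁ p`,
`e₂ = semistabilityIndex W₂ p` and `(p−1) ∤ lcm(e₁, e₂)`; `L₁`, `L₂` ANY ramified ordinary lines at
`v ∋ p`. Then every `Γ_ℚ`-equivariant `e : E₁[p] ≃+ E₂[p]` satisfies `P ∈ C₁ ↔ e P ∈ C₂`. (S3 fed
with FILE B's exponents `e₁`, `e₂`.) [cite: GreenbergVatsal2000, §2 p. 26 and Remark (2.9)]
[cite: EmertonPollackWeston2006, pp. 2–3 and §3.1 (eq:ordes) (arXiv:math/0404484 p. 17)] -/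
theorem inclusion_mem_iff_of_typeGOrd_typeGOrd_of_not_dvd_lcm (hp5 : 5 ≤ p)
    (hG₁ : TypeGOrd W₁ p) (hadd₁ : Addv W₁ p) (hG₂ : TypeGOrd W₂ p) (hadd₂ : Addv W₂ p)
    (hlcm : ¬ (p - 1) ∣ Nat.lcm (semistabilityIndex W₁ p) (semistabilityIndex W₂ p))
    (hpv : ((p : ℕ) : 𝓞 ℚ) ∈ v.asIdeal)
    {L₁ : LocalDatum ℚ ↥(W₁.geomPrimaryTorsion p) v} {L₂ : LocalDatum ℚ ↥(W₂.geomPrimaryTorsion p) v}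
    (hL₁ : IsRamifiedOrdinaryLine W₁ p L₁) (hL₂ : IsRamifiedOrdinaryLine W₂ p L₂)
    (e : ↥(geomTorsion W₁ (p : ℤ)) ≃+ ↥(geomTorsion W₂ (p : ℤ)))
    (he : ∀ (σ : absoluteGaloisGroup ℚ) (P : ↥(geomTorsion W₁ (p : ℤ))), e (σ • P) = σ • e P)
    (P : ↥(geomTorsion W₁ (p : ℤ))) :
    AddSubgroup.inclusion (geomTorsion_le_geomPrimaryTorsion W₁ p) P ∈ L₁.plus ↔
      AddSubgroup.inclusion (geomTorsion_le_geomPrimaryTorsion W₂ p) (e P) ∈ L₂.plus :=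
  hL₁.inclusion_mem_iff_of_not_dvd_lcm_of_equivariant hL₂ hpv
    (hL₁.pow_semistabilityIndex_smul_sub_mem hp5 hG₁ hadd₁ hpv)
    (hL₂.pow_semistabilityIndex_smul_sub_mem hp5 hG₂ hadd₂ hpv) hlcm e he P

/-- **LINE MATCHING IS AUTOMATIC on a Gord × Gord link off the swap locus** (existential packaging,
the shape of p07's `exists_lines_matching_*` / p12's `hlines` at one `v`): `p ≥ 5`, both members
(G)-ordinary additive of ANY defects with `(p−1) ∤ lcm(e₁, e₂)` ⟹ there are ramified ordinary lines
`L₁`, `L₂` at `v ∋ p` matched by EVERY `Γ_ℚ`-equivariant `E₁[p] ≃+ E₂[p]`. Covers e.g. every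
`e₁ = e₂ = 3` link at `p = 7`, every link at `p ≥ 17`, and at `p = 13` all but `{e₁,e₂} ∈ {{3,4},{4,6}}`.
[cite: GreenbergVatsal2000, §2 p. 26 and Remark (2.9)]
[cite: EmertonPollackWeston2006, pp. 2–3 and §3.1 (eq:ordes) (arXiv:math/0404484 p. 17)] -/
theorem exists_lines_matching_of_typeGOrd_typeGOrd_of_not_dvd_lcm (hp5 : 5 ≤ p)
    (hG₁ : TypeGOrd W₁ p) (hadd₁ : Addv W₁ p) (hG₂ : TypeGOrd W₂ p) (hadd₂ : Addv W₂ p)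
    (hlcm : ¬ (p - 1) ∣ Nat.lcm (semistabilityIndex W₁ p) (semistabilityIndex W₂ p))
    (hpv : ((p : ℕ) : 𝓞 ℚ) ∈ v.asIdeal) :
    ∃ (L₁ : LocalDatum ℚ ↥(W₁.geomPrimaryTorsion p) v) (L₂ : LocalDatum ℚ ↥(W₂.geomPrimaryTorsion p) v),
      IsRamifiedOrdinaryLine W₁ p L₁ ∧ IsRamifiedOrdinaryLine W₂ p L₂ ∧
      ∀ e : ↥(geomTorsion W₁ (p : ℤ)) ≃+ ↥(geomTorsion W₂ (p : ℤ)),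
        (∀ (σ : absoluteGaloisGroup ℚ) (P : ↥(geomTorsion W₁ (p : ℤ))), e (σ • P) = σ • e P) →
        ∀ P : ↥(geomTorsion W₁ (p : ℤ)),
          AddSubgroup.inclusion (geomTorsion_le_geomPrimaryTorsion W₁ p) P ∈ L₁.plus ↔
            AddSubgroup.inclusion (geomTorsion_le_geomPrimaryTorsion W₂ p) (e P) ∈ L₂.plus := by
  obtain ⟨L₁, hL₁, hn₁⟩ :=
    exists_isRamifiedOrdinaryLine_and_pow_semistabilityIndex_of_typeGOrd hp5 hG₁ hadd₁ hpv
  obtain ⟨L₂, hL₂, hn₂⟩ :=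
    exists_isRamifiedOrdinaryLine_and_pow_semistabilityIndex_of_typeGOrd hp5 hG₂ hadd₂ hpv
  exact hL₁.exists_lines_matching_of_not_dvd_lcm hL₂ hpv hn₁ hn₂ hlcm

/-- **X4♯(G-ord) × X4♯(G-ord), `p ≥ 5`, any defects, off the swap locus: line matching is
automatic.** X4♯(G-ord) stays CONSTRUCTION-SHAPED; nothing booked. [cite: GreenbergVatsal2000, §2 p. 26 and Remark (2.9)] -/
theorem ClassX4Gord.exists_lines_matching_of_not_dvd_lcm (hp5 : 5 ≤ p) (hX₁ : ClassX4Gord W₁ p)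
    (hX₂ : ClassX4Gord W₂ p)
    (hlcm : ¬ (p - 1) ∣ Nat.lcm (semistabilityIndex W₁ p) (semistabilityIndex W₂ p))
    (hpv : ((p : ℕ) : 𝓞 ℚ) ∈ v.asIdeal) :
    ∃ (L₁ : LocalDatum ℚ ↥(W₁.geomPrimaryTorsion p) v) (L₂ : LocalDatum ℚ ↥(W₂.geomPrimaryTorsion p) v),
      IsRamifiedOrdinaryLine W₁ p L₁ ∧ IsRamifiedOrdinaryLine W₂ p L₂ ∧
      ∀ e : ↥(geomTorsion W₁ (p : ℤ)) ≃+ ↥(geomTorsion W₂ (p : ℤ)),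
        (∀ (σ : absoluteGaloisGroup ℚ) (P : ↥(geomTorsion W₁ (p : ℤ))), e (σ • P) = σ • e P) →
        ∀ P : ↥(geomTorsion W₁ (p : ℤ)),
          AddSubgroup.inclusion (geomTorsion_le_geomPrimaryTorsion W₁ p) P ∈ L₁.plus ↔
            AddSubgroup.inclusion (geomTorsion_le_geomPrimaryTorsion W₂ p) (e P) ∈ L₂.plus :=
  exists_lines_matching_of_typeGOrd_typeGOrd_of_not_dvd_lcm hp5 hX₁.typeGOrd hX₁.addv.2 hX₂.typeGOrd
    hX₂.addv.2 hlcm hpv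

/-- **X3♯(G-ord) × X3♯(G-ord), `p ≥ 5`, any defects, off the swap locus: line matching is automatic**
(reducibility of `E[p]` is irrelevant to the local argument). X3♯(G-ord) stays CONSTRUCTION-SHAPED;
nothing booked. [cite: GreenbergVatsal2000, §2 p. 26 and Remark (2.9)] -/
theorem ClassX3Gord.exists_lines_matching_of_not_dvd_lcm (hp5 : 5 ≤ p) (hX₁ : ClassX3Gord W₁ p)
    (hX₂ : ClassX3Gord W₂ p)
    (hlcm : ¬ (p - 1) ∣ Nat.lcm (semistabilityIndex W₁ p) (semistabilityIndex W₂ p))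
    (hpv : ((p : ℕ) : 𝓞 ℚ) ∈ v.asIdeal) :
    ∃ (L₁ : LocalDatum ℚ ↥(W₁.geomPrimaryTorsion p) v) (L₂ : LocalDatum ℚ ↥(W₂.geomPrimaryTorsion p) v),
      IsRamifiedOrdinaryLine W₁ p L₁ ∧ IsRamifiedOrdinaryLine W₂ p L₂ ∧
      ∀ e : ↥(geomTorsion W₁ (p : ℤ)) ≃+ ↥(geomTorsion W₂ (p : ℤ)),
        (∀ (σ : absoluteGaloisGroup ℚ) (P : ↥(geomTorsion W₁ (p : ℤ))), e (σ • P) = σ • e P) →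
        ∀ P : ↥(geomTorsion W₁ (p : ℤ)),
          AddSubgroup.inclusion (geomTorsion_le_geomPrimaryTorsion W₁ p) P ∈ L₁.plus ↔
            AddSubgroup.inclusion (geomTorsion_le_geomPrimaryTorsion W₂ p) (e P) ∈ L₂.plus :=
  exists_lines_matching_of_typeGOrd_typeGOrd_of_not_dvd_lcm hp5 hX₁.typeGOrd hX₁.addv hX₂.typeGOrd
    hX₂.addv hlcm hpv

/-- **The `∀ v ∋ p` packaging** — p12's `hlines` binder of `GreenbergVatsalTransferCountModelFree`
VERBATIM, on a Gord × Gord link of any defects off the swap locus (`p ≥ 5`).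
[cite: GreenbergVatsal2000, §2 p. 26 and Remark (2.9)] -/
theorem forall_exists_lines_matching_of_typeGOrd_typeGOrd_of_not_dvd_lcm (hp5 : 5 ≤ p)
    (hG₁ : TypeGOrd W₁ p) (hadd₁ : Addv W₁ p) (hG₂ : TypeGOrd W₂ p) (hadd₂ : Addv W₂ p)
    (hlcm : ¬ (p - 1) ∣ Nat.lcm (semistabilityIndex W₁ p) (semistabilityIndex W₂ p)) :
    ∀ (v : HeightOneSpectrum (𝓞 ℚ)) (_ : ((p : ℕ) : 𝓞 ℚ) ∈ v.asIdeal),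
      ∃ (L₁ : LocalDatum ℚ ↥(W₁.geomPrimaryTorsion p) v) (L₂ : LocalDatum ℚ ↥(W₂.geomPrimaryTorsion p) v),
        IsRamifiedOrdinaryLine W₁ p L₁ ∧ IsRamifiedOrdinaryLine W₂ p L₂ ∧
        ∀ e : ↥(geomTorsion W₁ (p : ℤ)) ≃+ ↥(geomTorsion W₂ (p : ℤ)),
          (∀ (σ : absoluteGaloisGroup ℚ) (P : ↥(geomTorsion W₁ (p : ℤ))), e (σ • P) = σ • e P) →
          ∀ P : ↥(geomTorsion W₁ (p : ℤ)),
            AddSubgroup.inclusion (geomTorsion_le_geomPrimaryTorsion W₁ p) P ∈ L₁.plus ↔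
              AddSubgroup.inclusion (geomTorsion_le_geomPrimaryTorsion W₂ p) (e P) ∈ L₂.plus :=
  fun _ hpv ↦ exists_lines_matching_of_typeGOrd_typeGOrd_of_not_dvd_lcm hp5 hG₁ hadd₁ hG₂ hadd₂ hlcm hpv

end GordGord

end GordHigherLineMatching

end Summit.BirchSwinnertonDyer.Rank1Residual.Additive

/-! ### §2 Gord × (M) and (M) × Gord links (mod A40/A41) -/

namespace Summit.BirchSwinnertonDyer.Rank1Residual.AdditivePotMult

namespace GordHigherLineMatching

open Summit.BirchSwinnertonDyer.Rank1Residual.Additive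

variable {W₁ W₂ : WeierstrassCurve ℚ} [W₁.IsElliptic] [W₂.IsElliptic] {p : ℕ} [hp : Fact p.Prime]
  {v : HeightOneSpectrum (𝓞 ℚ)}

/-- **LINE MATCHING IS AUTOMATIC on a Gord × (M) link off the swap locus** (mod A40/A41): `p ≥ 5`,
`E₁` (G)-ordinary additive of ANY defect `e₁` (globally minimal), `E₂` potentially multiplicative,
`(p−1) ∤ lcm(e₁, 2)` ⟹ ramified ordinary lines at `v ∋ p` matched by every `Γ_ℚ`-equivariant
`E₁[p] ≃+ E₂[p]` (exponents `e₁` from FILE B, `2` from FILE B0's Tate-twist quotient shape).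
Covered e.g.: every link at `p = 13` (`12 ∤ lcm(e₁, 2) ∈ {2,4,6}`) and at `p ≥ 17`; excluded are
exactly the links with `(p−1) ∣ lcm(e₁, 2)`: (5;4,M), (7;3,M), (7;6,M) (and defect 2 at `p ∈ {3}`, where
p07's twist-model theorems apply instead).
[cite: GreenbergVatsal2000, §2 pp. 14–15, p. 26 and Remark (2.9)]
[cite: EmertonPollackWeston2006, pp. 2–3 and §3.1 (eq:ordes) (arXiv:math/0404484 p. 17)]
[cite: SilvermanATAEC1994, Ch. V Thm. 5.3, Cor. 5.4] -/
theorem exists_lines_matching_of_typeGOrd_potMult_of_not_dvd_lcm [W₁.IsGloballyMinimal]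
    (hT40 : Silverman1994_thmV53_tateUniformisation.{0})
    (hT41 : Silverman1994_thmV53_corV54_tateUniformisation.{0}) (hp5 : 5 ≤ p)
    (hG₁ : TypeGOrd W₁ p) (hadd₁ : Addv W₁ p) (hpm₂ : PotMult W₂ p)
    (hlcm : ¬ (p - 1) ∣ Nat.lcm (semistabilityIndex W₁ p) 2)
    (hpv : ((p : ℕ) : 𝓞 ℚ) ∈ v.asIdeal) :
    ∃ (L₁ : LocalDatum ℚ ↥(W₁.geomPrimaryTorsion p) v) (L₂ : LocalDatum ℚ ↥(W₂.geomPrimaryTorsion p) v),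
      IsRamifiedOrdinaryLine W₁ p L₁ ∧ IsRamifiedOrdinaryLine W₂ p L₂ ∧
      ∀ e : ↥(geomTorsion W₁ (p : ℤ)) ≃+ ↥(geomTorsion W₂ (p : ℤ)),
        (∀ (σ : absoluteGaloisGroup ℚ) (P : ↥(geomTorsion W₁ (p : ℤ))), e (σ • P) = σ • e P) →
        ∀ P : ↥(geomTorsion W₁ (p : ℤ)),
          AddSubgroup.inclusion (geomTorsion_le_geomPrimaryTorsion W₁ p) P ∈ L₁.plus ↔
            AddSubgroup.inclusion (geomTorsion_le_geomPrimaryTorsion W₂ p) (e P) ∈ L₂.plus := by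
  have hp2 : p ≠ 2 := by omega
  obtain ⟨L₁, hL₁, hn₁⟩ :=
    exists_isRamifiedOrdinaryLine_and_pow_semistabilityIndex_of_typeGOrd hp5 hG₁ hadd₁ hpv
  obtain ⟨L₂, hL₂, hn₂⟩ := hpm₂.exists_isRamifiedOrdinaryLine_and_sq hT40 hT41 hp2 hpv
  exact hL₁.exists_lines_matching_of_not_dvd_lcm hL₂ hpv hn₁ hn₂ hlcm

/-- **LINE MATCHING IS AUTOMATIC on an (M) × Gord link off the swap locus** (mod A40/A41): the
symmetric form, receiver potentially multiplicative, partner (G)-ordinary of any defect `e₂`,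
`(p−1) ∤ lcm(2, e₂)`. [cite: GreenbergVatsal2000, §2 pp. 14–15, p. 26 and Remark (2.9)]
[cite: EmertonPollackWeston2006, pp. 2–3 and §3.1 (eq:ordes) (arXiv:math/0404484 p. 17)] -/
theorem exists_lines_matching_of_potMult_typeGOrd_of_not_dvd_lcm [W₂.IsGloballyMinimal]
    (hT40 : Silverman1994_thmV53_tateUniformisation.{0})
    (hT41 : Silverman1994_thmV53_corV54_tateUniformisation.{0}) (hp5 : 5 ≤ p)
    (hpm₁ : PotMult W₁ p) (hG₂ : TypeGOrd W₂ p) (hadd₂ : Addv W₂ p)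
    (hlcm : ¬ (p - 1) ∣ Nat.lcm 2 (semistabilityIndex W₂ p))
    (hpv : ((p : ℕ) : 𝓞 ℚ) ∈ v.asIdeal) :
    ∃ (L₁ : LocalDatum ℚ ↥(W₁.geomPrimaryTorsion p) v) (L₂ : LocalDatum ℚ ↥(W₂.geomPrimaryTorsion p) v),
      IsRamifiedOrdinaryLine W₁ p L₁ ∧ IsRamifiedOrdinaryLine W₂ p L₂ ∧
      ∀ e : ↥(geomTorsion W₁ (p : ℤ)) ≃+ ↥(geomTorsion W₂ (p : ℤ)),
        (∀ (σ : absoluteGaloisGroup ℚ) (P : ↥(geomTorsion W₁ (p : ℤ))), e (σ • P) = σ • e P) →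
        ∀ P : ↥(geomTorsion W₁ (p : ℤ)),
          AddSubgroup.inclusion (geomTorsion_le_geomPrimaryTorsion W₁ p) P ∈ L₁.plus ↔
            AddSubgroup.inclusion (geomTorsion_le_geomPrimaryTorsion W₂ p) (e P) ∈ L₂.plus := by
  have hp2 : p ≠ 2 := by omega
  obtain ⟨L₁, hL₁, hn₁⟩ := hpm₁.exists_isRamifiedOrdinaryLine_and_sq hT40 hT41 hp2 hpv
  obtain ⟨L₂, hL₂, hn₂⟩ :=
    exists_isRamifiedOrdinaryLine_and_pow_semistabilityIndex_of_typeGOrd hp5 hG₂ hadd₂ hpv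
  exact hL₁.exists_lines_matching_of_not_dvd_lcm hL₂ hpv hn₁ hn₂ hlcm

/-- **MATCHING OF ANY GIVEN LINES on a Gord × (M) link off the swap locus** (mod A40/A41; `∀`-lines
form). [cite: GreenbergVatsal2000, §2 p. 26 and Remark (2.9)] -/
theorem inclusion_mem_iff_of_typeGOrd_potMult_of_not_dvd_lcm [W₁.IsGloballyMinimal]
    (hT40 : Silverman1994_thmV53_tateUniformisation.{0})
    (hT41 : Silverman1994_thmV53_corV54_tateUniformisation.{0}) (hp5 : 5 ≤ p)
    (hG₁ : TypeGOrd W₁ p) (hadd₁ : Addv W₁ p) (hpm₂ : PotMult W₂ p)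
    (hlcm : ¬ (p - 1) ∣ Nat.lcm (semistabilityIndex W₁ p) 2)
    (hpv : ((p : ℕ) : 𝓞 ℚ) ∈ v.asIdeal)
    {L₁ : LocalDatum ℚ ↥(W₁.geomPrimaryTorsion p) v} {L₂ : LocalDatum ℚ ↥(W₂.geomPrimaryTorsion p) v}
    (hL₁ : IsRamifiedOrdinaryLine W₁ p L₁) (hL₂ : IsRamifiedOrdinaryLine W₂ p L₂)
    (e : ↥(geomTorsion W₁ (p : ℤ)) ≃+ ↥(geomTorsion W₂ (p : ℤ)))
    (he : ∀ (σ : absoluteGaloisGroup ℚ) (P : ↥(geomTorsion W₁ (p : ℤ))), e (σ • P) = σ • e P)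
    (P : ↥(geomTorsion W₁ (p : ℤ))) :
    AddSubgroup.inclusion (geomTorsion_le_geomPrimaryTorsion W₁ p) P ∈ L₁.plus ↔
      AddSubgroup.inclusion (geomTorsion_le_geomPrimaryTorsion W₂ p) (e P) ∈ L₂.plus := by
  have hp2 : p ≠ 2 := by omega
  exact hL₁.inclusion_mem_iff_of_not_dvd_lcm_of_equivariant hL₂ hpv
    (hL₁.pow_semistabilityIndex_smul_sub_mem hp5 hG₁ hadd₁ hpv)
    (hpm₂.sq_smul_sub_mem_of_isRamifiedOrdinaryLine hT40 hT41 hp2 hpv hL₂) hlcm e he P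

/-- **The `∀ v ∋ p` packaging** (p12's `hlines` VERBATIM) on a Gord × (M) link off the swap locus.
[cite: GreenbergVatsal2000, §2 p. 26 and Remark (2.9)] -/
theorem forall_exists_lines_matching_of_typeGOrd_potMult_of_not_dvd_lcm [W₁.IsGloballyMinimal]
    (hT40 : Silverman1994_thmV53_tateUniformisation.{0})
    (hT41 : Silverman1994_thmV53_corV54_tateUniformisation.{0}) (hp5 : 5 ≤ p)
    (hG₁ : TypeGOrd W₁ p) (hadd₁ : Addv W₁ p) (hpm₂ : PotMult W₂ p)
    (hlcm : ¬ (p - 1) ∣ Nat.lcm (semistabilityIndex W₁ p) 2) :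
    ∀ (v : HeightOneSpectrum (𝓞 ℚ)) (_ : ((p : ℕ) : 𝓞 ℚ) ∈ v.asIdeal),
      ∃ (L₁ : LocalDatum ℚ ↥(W₁.geomPrimaryTorsion p) v) (L₂ : LocalDatum ℚ ↥(W₂.geomPrimaryTorsion p) v),
        IsRamifiedOrdinaryLine W₁ p L₁ ∧ IsRamifiedOrdinaryLine W₂ p L₂ ∧
        ∀ e : ↥(geomTorsion W₁ (p : ℤ)) ≃+ ↥(geomTorsion W₂ (p : ℤ)),
          (∀ (σ : absoluteGaloisGroup ℚ) (P : ↥(geomTorsion W₁ (p : ℤ))), e (σ • P) = σ • e P) →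
          ∀ P : ↥(geomTorsion W₁ (p : ℤ)),
            AddSubgroup.inclusion (geomTorsion_le_geomPrimaryTorsion W₁ p) P ∈ L₁.plus ↔
              AddSubgroup.inclusion (geomTorsion_le_geomPrimaryTorsion W₂ p) (e P) ∈ L₂.plus :=
  fun _ hpv ↦ exists_lines_matching_of_typeGOrd_potMult_of_not_dvd_lcm hT40 hT41 hp5 hG₁ hadd₁ hpm₂ hlcm hpv

/-- **The `∀ v ∋ p` packaging** (p12's `hlines` VERBATIM) on an (M) × Gord link off the swap locus.
[cite: GreenbergVatsal2000, §2 p. 26 and Remark (2.9)] -/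
theorem forall_exists_lines_matching_of_potMult_typeGOrd_of_not_dvd_lcm [W₂.IsGloballyMinimal]
    (hT40 : Silverman1994_thmV53_tateUniformisation.{0})
    (hT41 : Silverman1994_thmV53_corV54_tateUniformisation.{0}) (hp5 : 5 ≤ p)
    (hpm₁ : PotMult W₁ p) (hG₂ : TypeGOrd W₂ p) (hadd₂ : Addv W₂ p)
    (hlcm : ¬ (p - 1) ∣ Nat.lcm 2 (semistabilityIndex W₂ p)) :
    ∀ (v : HeightOneSpectrum (𝓞 ℚ)) (_ : ((p : ℕ) : 𝓞 ℚ) ∈ v.asIdeal),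
      ∃ (L₁ : LocalDatum ℚ ↥(W₁.geomPrimaryTorsion p) v) (L₂ : LocalDatum ℚ ↥(W₂.geomPrimaryTorsion p) v),
        IsRamifiedOrdinaryLine W₁ p L₁ ∧ IsRamifiedOrdinaryLine W₂ p L₂ ∧
        ∀ e : ↥(geomTorsion W₁ (p : ℤ)) ≃+ ↥(geomTorsion W₂ (p : ℤ)),
          (∀ (σ : absoluteGaloisGroup ℚ) (P : ↥(geomTorsion W₁ (p : ℤ))), e (σ • P) = σ • e P) →
          ∀ P : ↥(geomTorsion W₁ (p : ℤ)),
            AddSubgroup.inclusion (geomTorsion_le_geomPrimaryTorsion W₁ p) P ∈ L₁.plus ↔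
              AddSubgroup.inclusion (geomTorsion_le_geomPrimaryTorsion W₂ p) (e P) ∈ L₂.plus :=
  fun _ hpv ↦ exists_lines_matching_of_potMult_typeGOrd_of_not_dvd_lcm hT40 hT41 hp5 hpm₁ hG₂ hadd₂ hlcm hpv

end GordHigherLineMatching

end Summit.BirchSwinnertonDyer.Rank1Residual.AdditivePotMult

end
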